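import Summits.CriticalPhenomena.SAWScalingLimit.Theorems.SAWLoopFugacityFlowAvoidanceLimitExcursionRatioSelf

/-!
# The falsifiable core of stub `stub_fugacityContinuation` (line `symplectic-fermion-anchor`,
crux `SAWLoopFugacityFlow.AvoidanceLimit`, stmt-CriticalPhenomena-10649): zero-freeness at `D' = D`

The stub `FugacityContinuation` quantifies over ALL hull geometries `(D, D', a, b)`; the trivial hull
subdomain `D' = D` is one of them (`D'.carrier ⊆ D.carrier`, same marked points, ball agreement for
any radius). There the confined graph is `Ω_δ` itself (`confinedGraph_self_eq`, companion file of
`stub_excursionRatio`), so the route's doubly normalised ratio collapses to `T / T`, `T` the two-leg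
function of `Ω_δ` (`Rδ_self_eq_div`), a function with values in `{0, 1}` (Lean's `0 / 0 = 0`).
Continuity of `z ↦ R_δ` on a preconnected `U` — a fortiori the complex differentiability the stub
asserts for every `δ < δ₀` — therefore PROPAGATES non-vanishing of `T` from one point of `U` to all
of `U` (`twoLegDim_ne_zero_of_continuousOn_Rδ_self`, intermediate value theorem for `re (T/T)`),
i.e. forces BOTH finite-volume partition functions `Z(Ω_δ; {a} ∆ {b})` and `Z(Ω_δ; ∅)` to be
zero-free on all of `U` along the parameter curve (registered sub-goal
`dimerPF_ne_zero_of_continuousOn_ratio_self`). With the curve `(z, z/2, Xc z)`, `Xc 0 = x_c(0,0) =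
1/μ > 0`, and `T(0) =` the SAW two-point generating function `> 0` for joined legs, this is the
δ-UNIFORM absence of complex-fugacity (Lee–Yang type) zeros of the signed/complex dressed partition
functions on the fixed neighbourhood `U ⊇ [-2+η, 0]`, for every Jordan domain and every endpoint
approximation — the statement a lattice refutation of the stub would have to violate, and the open
content a proof has to supply.

Sources: T. D. Lee, C. N. Yang, Phys. Rev. 87 (1952) 410 (zeros of partition functions and
analyticity) [LeeYang1952]; J. L. Jacobsen, LNP 775 (2009), ch. 14, p. 367 (complex loop fugacity)
[Jacobsen2009]. No new definitions.
-/

noncomputable section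

open scoped BigOperators Topology symmDiff
open Filter Finset
open Literature.Probability.RandomPlanarGeometry Literature.Probability.LatticeModels

namespace Summit.CriticalPhenomena.SAWScalingLimit.Theorems.AvoidanceLimit.Anchor

section KField

variable {K : Type*} [Field K]

/-- `twoLegDim` transports along an equality of graphs (the `LocallyFinite` structure is a
subsingleton). [folklore] -/
theorem twoLegDim_congr_graph {G G' : SimpleGraph (Site 2)} [iG : G.LocallyFinite]
    [iG' : G'.LocallyFinite] (hG : G = G') (n t x : K) (Λ : Finset (Site 2)) (a b : Site 2) :
    @twoLegDim K _ n t x G iG Λ a b = @twoLegDim K _ n t x G' iG' Λ a b := by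
  subst hG
  have : iG = iG' := Subsingleton.elim _ _
  subst this
  rfl

/-- **At `S = Ω` the route's ratio is `T / T`**, `T = twoLegDim n t x Ω_δ (meshDomainFinset Ω δ) a b`
the two-leg function of the discretised domain: the numerator's confined graph is `Ω_δ` itself.
[folklore] -/
theorem Rδ_self_eq_div (n t x : K) (Ω : Set ℂ) (δ : ℝ) (a b : Site 2) :
    Rδ n t x Ω Ω δ a b =
      twoLegDim n t x (discreteDomainGraph Ω δ) (meshDomainFinset Ω δ) a b /
        twoLegDim n t x (discreteDomainGraph Ω δ) (meshDomainFinset Ω δ) a b := by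
  rw [Rδ, ratioDim, twoLegDim_congr_graph (confinedGraph_self_eq Ω δ)]

/-- At `S = Ω` the ratio takes only the values `0` (where `T = 0`, junk `0 / 0`) and `1`. [folklore] -/
theorem Rδ_self_eq_ite [DecidableEq K] (n t x : K) (Ω : Set ℂ) (δ : ℝ) (a b : Site 2) :
    Rδ n t x Ω Ω δ a b =
      if twoLegDim n t x (discreteDomainGraph Ω δ) (meshDomainFinset Ω δ) a b = 0 then 0 else 1 := by
  rw [Rδ_self_eq_div]
  split_ifs with h
  · rw [h, div_zero]
  · rw [div_self h]

end KField

/-- **Propagation of non-vanishing.** If the `S = Ω` ratio `z ↦ R_δ(f z, g z, h z; Ω, Ω)` is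
continuous on a preconnected set `U` of complex parameters and the two-leg function `T` of `Ω_δ` is
non-zero at ONE point of `U`, then `T` is non-zero at EVERY point of `U`: `re (T/T)` is a continuous
`{0, 1}`-valued function on `U`, equal to `1` somewhere, so by the intermediate value theorem it never
takes the value `0`. [cite: LeeYang1952] -/
theorem twoLegDim_ne_zero_of_continuousOn_Rδ_self {U : Set ℂ} (hU : IsPreconnected U)
    {f g h : ℂ → ℂ} {Ω : Set ℂ} {δ : ℝ} {a b : Site 2}
    (hR : ContinuousOn (fun z => Rδ (f z) (g z) (h z) Ω Ω δ a b) U) {z₀ : ℂ} (hz₀ : z₀ ∈ U)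
    (h₀ : twoLegDim (f z₀) (g z₀) (h z₀) (discreteDomainGraph Ω δ) (meshDomainFinset Ω δ) a b ≠ 0)
    {z : ℂ} (hz : z ∈ U) :
    twoLegDim (f z) (g z) (h z) (discreteDomainGraph Ω δ) (meshDomainFinset Ω δ) a b ≠ 0 := by
  intro hTz
  have hfun : (fun w => Rδ (f w) (g w) (h w) Ω Ω δ a b) = fun w =>
      twoLegDim (f w) (g w) (h w) (discreteDomainGraph Ω δ) (meshDomainFinset Ω δ) a b /
        twoLegDim (f w) (g w) (h w) (discreteDomainGraph Ω δ) (meshDomainFinset Ω δ) a b :=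
    funext fun w => Rδ_self_eq_div _ _ _ Ω δ a b
  rw [hfun] at hR
  have hcont := Complex.continuous_re.comp_continuousOn hR
  have hIVT := hU.intermediate_value hz hz₀ hcont
  have hmem : (1 / 2 : ℝ) ∈ Set.Icc
      ((twoLegDim (f z) (g z) (h z) (discreteDomainGraph Ω δ) (meshDomainFinset Ω δ) a b /
        twoLegDim (f z) (g z) (h z) (discreteDomainGraph Ω δ) (meshDomainFinset Ω δ) a b).re)
      ((twoLegDim (f z₀) (g z₀) (h z₀) (discreteDomainGraph Ω δ) (meshDomainFinset Ω δ) a b /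
        twoLegDim (f z₀) (g z₀) (h z₀) (discreteDomainGraph Ω δ) (meshDomainFinset Ω δ) a b).re) := by
    rw [hTz, div_zero, Complex.zero_re, div_self h₀, Complex.one_re]
    norm_num
  obtain ⟨w, -, hw⟩ := hIVT hmem
  dsimp only [Function.comp] at hw
  by_cases hTw : twoLegDim (f w) (g w) (h w) (discreteDomainGraph Ω δ) (meshDomainFinset Ω δ) a b = 0
  · rw [hTw, div_zero, Complex.zero_re] at hw
    norm_num at hw
  · rw [div_self hTw, Complex.one_re] at hw
    norm_num at hw

/-- The two-leg function is non-zero iff both partition functions are. [folklore] -/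
theorem twoLegDim_ne_zero_iff {K : Type*} [Field K] (n t x : K) (G : SimpleGraph (Site 2))
    [G.LocallyFinite] (Λ : Finset (Site 2)) (a b : Site 2) :
    twoLegDim n t x G Λ a b ≠ 0 ↔ dimerPF n t x G Λ ({a} ∆ {b}) ≠ 0 ∧ dimerPF n t x G Λ ∅ ≠ 0 := by
  rw [twoLegDim, div_ne_zero_iff]

/-! ## Registered sub-goal -/

/-- Registered sub-goal of this file (stub `stub_fugacityContinuation`): **the `D' = D` shadow of
`FugacityContinuation` is δ-uniform zero-freeness.** For a preconnected set `U` of complex parameters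
and any parameter curves `(f, g, h)` (the stub's: `(z, z/2, Xc z)`), continuity on `U` of the route's
ratio at `S = Ω` — implied by the differentiability the stub asserts at the hull geometry `D' = D`,
for every `δ < δ₀` with one and the same `U` — together with non-vanishing of the two-leg function of
`Ω_δ` at a single point of `U` (at `z₀ = 0`: the SAW two-point generating function at `x_c = 1/μ`,
positive once the legs are joined) forces BOTH dressed partition functions `Z(Ω_δ; {a} ∆ {b})` and
`Z(Ω_δ; ∅)` — signed on the real segment, complex off it — to have NO zero on `U`.
[cite: LeeYang1952] -/
theorem dimerPF_ne_zero_of_continuousOn_ratio_self :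
    ∀ (U : Set ℂ), IsPreconnected U → ∀ (f g h : ℂ → ℂ) (Ω : Set ℂ) (δ : ℝ) (a b : Site 2),
      ContinuousOn (fun z => Rδ (f z) (g z) (h z) Ω Ω δ a b) U →
      ∀ z₀ ∈ U, twoLegDim (f z₀) (g z₀) (h z₀) (discreteDomainGraph Ω δ) (meshDomainFinset Ω δ) a b ≠ 0 →
      ∀ z ∈ U, dimerPF (f z) (g z) (h z) (discreteDomainGraph Ω δ) (meshDomainFinset Ω δ) ({a} ∆ {b}) ≠ 0 ∧
        dimerPF (f z) (g z) (h z) (discreteDomainGraph Ω δ) (meshDomainFinset Ω δ) ∅ ≠ 0 :=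
  fun _ hU f g h _ _ a b hR _ hz₀ h₀ _ hz =>
    (twoLegDim_ne_zero_iff (f _) (g _) (h _) _ _ a b).1
      (twoLegDim_ne_zero_of_continuousOn_Rδ_self hU hR hz₀ h₀ hz)

end Summit.CriticalPhenomena.SAWScalingLimit.Theorems.AvoidanceLimit.Anchor

end
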